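import Summits.QuantumFields.YangMills.Theorems.BalabanUVNodesN15PerCubeGreenAdjointKnitLoc
import Summits.QuantumFields.YangMills.Theorems.BalabanUVNodesN15PerCubeGreenAdjointCovD
import Summits.QuantumFields.YangMills.Theorems.BalabanUVNodesN15CurvedAdjointLettersOfReg335UN
import Summits.QuantumFields.YangMills.Theorems.BalabanUVNodesN15PerCubeGreenJetReg335
import HarnessLib

/-!
# N15 = NE2, road (c) — PROGRAMME (PC), (PC-A″) ★★★★ THE THIRD SUP-NORM ENTRY OF [B9] (3.42) FOR THE NAMED `G′(U) = cGreen (cvT e U) a` AND EVERY `U(m)` FIELD IN BAŁABAN's PRINTED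
# CLASS (3.35) PER CUBE: `G′(U)∇*_U` — componentwise `mulVecLin (G′(U))∘D*_{U,ν} ≤ B(1 + r_V)e^{−(δ∕16)|y−y′|_T}` (site → site) and `mulVecLin (G′(U)·(D_U)ᵀ) ≤ (d+1)B(1 + r_V)e^{−(δ∕16)|y−y′|_T}`
# (bond → site), by the ADJOINT ARRANGEMENT with per-cube gauges (n15-c∕283′) fed with the dictionary n15-c∕284 and the (3.35) letters n15-c∕285 (dag-n15-c g27, n15-c∕286)

Cell `pub-ymgap`, seat `pub-ymgap-dag-n15-c` (generation g27; R134 (a), s1 «first missing estimate»; HUMAN RULING D-0062).  `bears_on: R4∕N15 · K3⁸ SpineGivenEndpointR13SepCoPHV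
(stmt-QuantumFields-27366)`; filed `--kind proof --supports stmt-QuantumFields-27366 --as helper` — COUNT-NEUTRAL.  One theorem + one pointwise lemma, 0 `def`, 0 `sorry`.  Imports BY NAME
n15-c∕283′ `…PerCubeGreenAdjointKnitLoc` (`uN_scAdj_rightInverse_loc_spec`), n15-c∕284 `…PerCubeGreenAdjointCovD` (`covD_symm_covShape`, `mulOp_comp_covD_symm`, `hasMaj_mulVecLin_mul_cgradT`),
n15-c∕285 `…CurvedAdjointLettersOfReg335UN` (`uN_exists_gauge_adjointLetters_of_reg335Cube`, the row lemmas, `uN_conj_coordMat_eq`), n15-c∕277 `…PerCubeGreenJetReg335` (through it n15-c∕265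
`scP_conj` ∕ `scNV_eq` ∕ `hasMaj_scNV_cut_of_rows` ∕ `csavgSq_sub_apply_of_ne`, n15-c∕266 `covLapM_add_scP_eq_mulVecLin_claplA` ∕ `isUnit_cvT`, n15-c∕275 `scChi_ne_zero_nbhd`, dag-n15-w2
`mem_cubeBlocks_of_mem_inner` ∕ `blockOf_shift_mem_cubeBlocks`, n15-c∕261 `scBump_eq_one_of_scH_ne_zero_of_blockOf_eq`).  Nothing in the tree is modified.  GENERATED (term macros) by the
seat's `gen/buildA5b.py`.

THE THEOREM `hasMaj_cGreen_adjGrad_of_reg335Box`.  For odd `L ≥ 7`, `a₀ > 0`, a colour index `ι`: there are `δ, R₀ > 0`, `w₀`, `B ≥ 0` such that on EVERY doubled torus of the cover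
(`k ≥ 1`, `L^m ≥ w₀`), at King's mass `a = a_K(a₀,L,k)·(L^k)^{d+1}`, for trace-form coordinates `e` of `𝔲(m)` and EVERY `U(m)`-valued site bond field `U` with `Reg335Cube (· + e_μ) U L^{−k}
Q_k ξ C` on the two-collar box `Q_k` of every cut box, and a letter `r_V` dominating the three explicit (3.35) bounds (`|ι|P`, the `c`-bound, `|ι|Q`; `P = κ_e2√m√m(C∕ξ)e^{ηC∕ξ}`,
`Q = κ_e2√m√m(C∕ξ²)e^{ηC∕ξ}`) with `r_V(1 + |J⊕J|) + a₀|ι|(|ι|σ² + 2σ) ≤ R₀` (`σ = (1 + r_VL^{−k})^{(d+1)L^k} − 1`):  for every direction `ν`,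
`mulVecLin (cGreen (cvT e U) a) ∘ D*_{U,ν} ≤ B(1 + r_V)·e^{−(δ∕16)|y−y′|_T}` (site → site), where `D*_{U,ν} = covD L^{−k} (x ↦ (cvT e U)_ν(x − e_ν)ᵀ) (· − e_ν) = (D_U)ᵀ∘ext_ν` (n15-c∕284
`mulVecLin_cgradT_comp_ext_eq_covD`), and `mulVecLin (cGreen (cvT e U) a·(cgrad (cvT e U))ᵀ) ≤ (d+1)B(1 + r_V)·e^{−(δ∕16)|y−y′|_T}` (bond → site) — NO global gauge, NO displayed row, no
gauge in the statement.

PROOF (all by name).  n15-c∕283′ with: per-cube gauges `w_k` from n15-c∕285 (ONE gauge per cube carrying the coefficient letters AND the four entry letters on the two-step interior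
of `Q_k`, which contains the cut box and its ±e_μ, +2e_μ translates); `P := scP`, `N_V := scNV` (n15-c∕265: `hP` by definition, the cut row from the letters, the far row
`M_{h_k}N_V k(1 − M_{χ̃_k}) = 0` EXACTLY by block-diagonality — `θ_F = 0`); `r_D := r_V` (285's quotient rows); the right factor `E := D*_{U,ν}` with `dh_k = ∇⁺_ν h_k` (284
`mulOp_comp_covD_symm`; `|dh_k| ≤ π∕L^m`), `M_{W_k}EM_{W_kᵀ} = M_{−R^{W_k}}∇⁻_ν + M_{L^k(R^{W_k} − 1)}` (284 `covD_symm_covShape`), rows `r_R = 1 + r_V`, `r_{∇R} = r_B = r_V` on the cut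
box (285); `Y := mulVecLin (cGreen (cvT e U) a)`, a right inverse of `Δ_{R_U} + P = mulVecLin (Δ′_a(U))` (n15-c∕266 + n15-c∕201b `claplA_mul_cGreen`).  The bond → site row: 284
`hasMaj_mulVecLin_mul_cgradT`.

HONEST FRAMING ∕ LIMITS.  A composition of LANDED theorems on MODEL carriers (the doubled-cube torus cover of n15-c∕119∕260, one scale, compressed torus Green's functions as local
propagators, King's window); the bond field `U` is LIVE through Bałaban's printed per-cube class (3.35) (lit-balaban r06's `Reg335Cube`, by name).  This is the SHAPE of the THIRD
entry of [B9] Thm 3.1 (3.42) ∕ Thm 3.7 ∕ Cor. 3.6 for the named `G′(U)` at MODEL level — NOT the printed theorem (no `L^{-j}` multi-scale class, no `M ≥ M₁(…)` bookkeeping beyond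
`w₀`, torus instead of the printed boundary conditions); nothing of [B5]∕[B6]∕[B9] asserted (pages cited = SHAPES ∕ MECHANISM).  NE2⁺ NOT PRINTED, NOT proved; N15 of record
untouched (DISCHARGED AS CONSUMED, p687738); K3⁸ OPEN; counts of record UNMOVED (typed 28∕28 · discharged 8∕27); one finite 𝕋⁴ at fixed ε per index — NOT infinite volume, NOT OS
on ℝ⁴, NOT a mass gap, NOT Clay.  Restate-immune (no Theses import).
-/

noncomputable section

open scoped BigOperators Matrix Matrix.Norms.L2Operator

namespace Summit.QuantumFields.YangMills.BalabanUVNodes.N15.Gluing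

open Real
open Literature.MathematicalPhysics.QuantumFieldTheory.Balaban1983to89
open Literature.MathematicalPhysics.QuantumFieldTheory.Balaban1983to89.B5Prop11Plancherel (Tor fine unitVec)
open Literature.MathematicalPhysics.QuantumFieldTheory.Balaban1983to89.B11SectG (BlockNorm HasMaj hasMaj_zero)
open Literature.MathematicalPhysics.QuantumFieldTheory.Balaban1983to89.B6Prop26Gluing (mulOp mulOp_apply)
open Literature.MathematicalPhysics.QuantumFieldTheory.Balaban1983to89.B6UnitTorusCarrier (unitTorusGeo)
open Literature.MathematicalPhysics.QuantumFieldTheory.Balaban1983to89.B9Eq335RegularityClasses (Reg335Cube)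
open Literature.MathematicalPhysics.QuantumFieldTheory.King1986 (aK aK_pos aK_le)
open Literature.MathematicalPhysics.QuantumFieldTheory.King1986.Torus (blockOf)
open Literature.Barriers.QuantumFields (traceForm)
open Summit.QuantumFields.YangMills.BalabanUVNodes.N15.BackgroundLayer (covLapM tCoefA tCoefC fgrad fgrad_apply bgrad fgradMat)
open Summit.QuantumFields.YangMills.BalabanUVNodes.N15.MatrixSpecies (mmulOp coordMat basisConst basisConst_nonneg liftEquiv liftBlk covD)
open Summit.QuantumFields.YangMills.BalabanUVNodes.N15.TwoGrid (chiCube cubeBlocks)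
open Summit.QuantumFields.YangMills.BalabanUVNodes.N15.CurvedSpecies (gaugePair uN_exists_gauge_adjointLetters_of_reg335Cube uN_conj_coordMat_eq rowSum_fgradMat_tCoefA_inl_le_at
  rowSum_fgradMat_tCoefA_inr_le_at rowSum_smul_conj_sub_one_le_at rowSum_fgradMat_neg_conj_le_at rowSum_neg_conj_shift_le_at uN_siteGauge_orthogonal)
open Summit.QuantumFields.YangMills.BalabanUVNodes.N15.CovLandau (cgrad cGreen claplA claplA_mul_cGreen)

variable {d : ℕ}

section Green

variable {L : ℕ} [NeZero L] {mv kk : ℕ} {hL : Odd L ∧ 1 < L} (ι : Type) [Fintype ι] [DecidableEq ι]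

omit [DecidableEq ι] in
/-- a block-diagonal site matrix between a partition function and the complement of a bump that is `1` on every block the partition function meets gives zero:
`M_h∘mulVecLin D∘(1 − M_{χ̃}) = 0` (n15-c∕265's `one_sub_mulOp_comp_mulVecLin_comp_mulOp_eq_zero`, sides swapped). [folklore] -/
theorem mulOp_comp_mulVecLin_comp_one_sub_mulOp_eq_zero (D : Matrix (ScX d L mv kk hL × ι) (ScX d L mv kk hL × ι) ℝ)
    (hD : ∀ p q, blockOf (L ^ kk) (cvM d L mv kk hL) q.1 ≠ blockOf (L ^ kk) (cvM d L mv kk hL) p.1 → D p q = 0) {h χ : ScX d L mv kk hL → ℝ}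
    (hhχ : ∀ x x', h x ≠ 0 → blockOf (L ^ kk) (cvM d L mv kk hL) x' = blockOf (L ^ kk) (cvM d L mv kk hL) x → χ x' = 1) :
    mulOp (fun p : ScX d L mv kk hL × ι => h p.1) ∘ₗ Matrix.mulVecLin D ∘ₗ (LinearMap.id - mulOp (fun p : ScX d L mv kk hL × ι => χ p.1)) = 0 := by
  classical
  refine LinearMap.ext fun f => funext fun p => ?_
  simp only [LinearMap.comp_apply, LinearMap.sub_apply, LinearMap.id_apply, mulOp_apply, LinearMap.zero_apply, Pi.zero_apply, Matrix.mulVecLin_apply, Matrix.mulVec, dotProduct,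
    Pi.sub_apply]
  by_cases h0 : h p.1 = 0
  · rw [h0, zero_mul]
  · rw [Finset.sum_eq_zero, mul_zero]
    intro q _
    by_cases hb : blockOf (L ^ kk) (cvM d L mv kk hL) q.1 = blockOf (L ^ kk) (cvM d L mv kk hL) p.1
    · rw [hhχ p.1 q.1 h0 hb, one_mul, sub_self, mul_zero]
    · rw [hD p q hb, zero_mul]

set_option maxHeartbeats 1600000 in
/-- ★★★★ **THE THIRD SUP-NORM ENTRY OF (3.42) FOR THE NAMED `G′(U)`, EVERY `U(m)` FIELD IN THE PRINTED CLASS (3.35) PER CUBE**: componentwise `mulVecLin (G′(U))∘D*_{U,ν} ≤ B(1 + r_V)e^{−(δ∕16)d}`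
(site → site) and `mulVecLin (G′(U)·(D_U)ᵀ) ≤ (d+1)B(1 + r_V)e^{−(δ∕16)d}` (bond → site).  MODEL carriers; the SHAPE of [B9] Thm 3.1 (3.42), third entry, NOT the printed theorem.
[cite: Balaban1985BackgroundPropagators, Thm 3.1 (3.42) p.397 (entry `G′(U)∇*_U`), Thm 3.7 (3.90) p.409, Cor. 3.6 p.408, (3.23)–(3.25) p.394, (3.34)–(3.35) p.396, (3.50) p.400, (3.59)–(3.65) pp.402–403 (shape ∕ mechanism); Balaban1984PropagatorsII, (2.91)–(2.93) p.239, (2.133)–(2.136) p.247 (transposed)] -/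
theorem hasMaj_cGreen_adjGrad_of_reg335Box (hL : Odd L ∧ 1 < L) (hL7 : 7 ≤ L) {a₀ : ℝ} (ha₀ : 0 < a₀) (ι : Type) [Fintype ι] [DecidableEq ι] :
    ∃ δ w₀ R₀ B : ℝ, 0 < δ ∧ 0 < R₀ ∧ 0 ≤ B ∧
      ∀ (mv kk : ℕ), 1 ≤ kk → w₀ ≤ ((L ^ mv : ℕ) : ℝ) →
      ∀ {mm : Type} [Fintype mm] [DecidableEq mm] [Nonempty mm] (e : Matrix mm mm ℂ ≃L[ℝ] (ι → ℝ)), (∀ A B : Matrix mm mm ℂ, traceForm A B = e A ⬝ᵥ e B) →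
      ∀ (U : Fin (d + 1) → ScX d L mv kk hL → (Matrix mm mm ℂ)ˣ), (∀ μ x, (U μ x : Matrix mm mm ℂ) ∈ Matrix.unitaryGroup mm ℂ) →
      ∀ (ξ C : ℝ), 0 < ξ → 0 ≤ C → (∀ k, Reg335Cube (scShift d L mv kk hL) U ((((L ^ kk : ℕ) : ℝ))⁻¹) {x : ScX d L mv kk hL | blockOf (L ^ kk) (cvM d L mv kk hL) x ∈ cubeBlocks (cvM d L mv kk hL) (coverCorner (cvM d L mv kk hL) (L ^ mv) L (2 * L ^ mv + 2) k) (6 * L ^ mv + 5)} ξ C) →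
      ∀ (rV : ℝ), 0 ≤ rV → Fintype.card ι * (@basisConst ι _ (Matrix mm mm ℂ) Matrix.frobeniusNormedAddCommGroup Matrix.frobeniusNormedSpace e * (2 * Real.sqrt (Fintype.card mm)) * (Real.sqrt (Fintype.card mm) * ((C / ξ) * Real.exp (((((L ^ kk : ℕ) : ℝ))⁻¹) * (C / ξ))))) ≤ rV → Fintype.card ι * (Fintype.card (Fin (d + 1)) * (Fintype.card ι * (@basisConst ι _ (Matrix mm mm ℂ) Matrix.frobeniusNormedAddCommGroup Matrix.frobeniusNormedSpace e * (2 * Real.sqrt (Fintype.card mm)) * (Real.sqrt (Fintype.card mm) * ((C / ξ) * Real.exp (((((L ^ kk : ℕ) : ℝ))⁻¹) * (C / ξ))))) ^ 2 + (@basisConst ι _ (Matrix mm mm ℂ) Matrix.frobeniusNormedAddCommGroup Matrix.frobeniusNormedSpace e * (2 * Real.sqrt (Fintype.card mm)) * (Real.sqrt (Fintype.card mm) * ((C / ξ ^ 2) * Real.exp (((((L ^ kk : ℕ) : ℝ))⁻¹) * (C / ξ))))))) ≤ rV → Fintype.card ι * (@basisConst ι _ (Matrix mm mm ℂ) Matrix.frobeniusNormedAddCommGroup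 Matrix.frobeniusNormedSpace e * (2 * Real.sqrt (Fintype.card mm)) * (Real.sqrt (Fintype.card mm) * ((C / ξ ^ 2) * Real.exp (((((L ^ kk : ℕ) : ℝ))⁻¹) * (C / ξ))))) ≤ rV →
        rV * (1 + Fintype.card (Fin (d + 1) ⊕ Fin (d + 1))) + a₀ * (Fintype.card ι * (Fintype.card ι * ((1 + rV * ((((L ^ kk : ℕ) : ℝ))⁻¹)) ^ ((d + 1) * L ^ kk) - 1) ^ 2 + 2 * ((1 + rV * ((((L ^ kk : ℕ) : ℝ))⁻¹)) ^ ((d + 1) * L ^ kk) - 1))) ≤ R₀ →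
      (∀ ν : Fin (d + 1), HasMaj (ScNorm d L mv kk hL ι) (ScNorm d L mv kk hL ι) ((Matrix.mulVecLin (cGreen (cvM d L mv kk hL) (L ^ kk) (cvT e (fun μ x => (U μ x : Matrix mm mm ℂ))) (aK a₀ (L : ℝ) kk * (((L ^ kk : ℕ) : ℝ)) ^ (d + 1)))) ∘ₗ covD ((((L ^ kk : ℕ) : ℝ))⁻¹) (fun y => ((cvT e (fun μ x => (U μ x : Matrix mm mm ℂ))) ν (((scShift d L mv kk hL) ν).symm y))ᵀ) ⇑((scShift d L mv kk hL) ν).symm)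
          (fun y y' => B * (1 + rV) * Real.exp (-(δ / 16 * (unitTorusGeo L kk (cvM d L mv kk hL)).dist y y')))) ∧
      HasMaj (BlockNorm.ofBlocks (unitTorusGeo L kk (cvM d L mv kk hL)) (liftBlk (fun b : ScX d L mv kk hL × Fin (d + 1) => blockOf (L ^ kk) (cvM d L mv kk hL) b.1) ι)) (ScNorm d L mv kk hL ι)
          (Matrix.mulVecLin (cGreen (cvM d L mv kk hL) (L ^ kk) (cvT e (fun μ x => (U μ x : Matrix mm mm ℂ))) (aK a₀ (L : ℝ) kk * (((L ^ kk : ℕ) : ℝ)) ^ (d + 1)) * (cgrad (cvM d L mv kk hL) (L ^ kk) (cvT e (fun μ x => (U μ x : Matrix mm mm ℂ))))ᵀ))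
          (fun y y' => ((d : ℝ) + 1) * (B * (1 + rV)) * Real.exp (-(δ / 16 * (unitTorusGeo L kk (cvM d L mv kk hL)).dist y y'))) := by
  obtain ⟨δ, w₀, R₀, θ₀, B₀, B₁, B₂, hδ, hR₀, hθ₀, hB₀, hB₁, hB₂, H⟩ := uN_scAdj_rightInverse_loc_spec (d := d) hL hL7 ha₀ ι
  refine ⟨δ, max w₀ 2, R₀, B₀ + B₁ + 2 * B₂, hδ, hR₀, by positivity, fun mv kk hk hw₀ => ?_⟩
  intro mm _ _ _ e he U hU ξ C hξ hC h335 rV hrV hrA hrC hrQ hRle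
  have hw₀' : w₀ ≤ ((L ^ mv : ℕ) : ℝ) := (le_max_left _ _).trans hw₀
  have hW2 : 2 ≤ L ^ mv := by have h := (le_max_right w₀ 2).trans hw₀; exact_mod_cast h
  have hw : 0 < L ^ mv := by omega
  have hL1r : (1 : ℝ) < (L : ℝ) := by exact_mod_cast hL.2
  have hn : 1 ≤ L ^ kk := Nat.one_le_pow _ _ (by omega)
  have hnr : (0 : ℝ) < ((L ^ kk : ℕ) : ℝ) := by exact_mod_cast hn
  have hη : (0 : ℝ) < ((((L ^ kk : ℕ) : ℝ))⁻¹) := inv_pos.mpr hnr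
  have hηle : ((((L ^ kk : ℕ) : ℝ))⁻¹) ≤ 1 := inv_le_one_of_one_le₀ (by exact_mod_cast hn)
  have hW1 : (1 : ℝ) ≤ ((L ^ mv : ℕ) : ℝ) := by exact_mod_cast hw
  have hM : ∀ ν, cvM d L mv kk hL ν = 2 * L * L ^ mv := MP_succ_eq L mv kk hL
  have hm₁ : 2 * L ^ mv ≤ coverMargin L mv := two_mul_le_coverMargin hL7 mv
  have hfitI : coverMargin L mv - 2 * L ^ mv + (6 * L ^ mv + 1) ≤ L * L ^ mv := coverMargin_inner_fit hL7 hW2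
  have hS0 : L * L ^ mv ≤ 2 * L * L ^ mv := by rw [mul_assoc]; omega
  have hS5 : 6 * L ^ mv + 5 ≤ 2 * L * L ^ mv := by
    have h7 : 7 * L ^ mv ≤ L * L ^ mv := Nat.mul_le_mul_right _ hL7
    have e2 : 2 * L * L ^ mv = 2 * (L * L ^ mv) := by ring
    rw [e2]; omega
  obtain ⟨hK0, hK2⟩ : 0 < 2 * L ∧ 2 ≤ 2 * L := ⟨by omega, by omega⟩
  -- King's window, the unitarity of `U`, the right inverse `Y := mulVecLin (G′(U))`
  have haK : 0 < aK a₀ (L : ℝ) kk := aK_pos ha₀ hL1r hk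
  have haKle : aK a₀ (L : ℝ) kk ≤ a₀ := aK_le ha₀ hL1r hk
  have ha' : 0 < (aK a₀ (L : ℝ) kk * (((L ^ kk : ℕ) : ℝ)) ^ (d + 1)) := by positivity
  have hU' : ∀ μ x, ((fun μ x => (U μ x : Matrix mm mm ℂ)) μ x)ᴴ * (fun μ x => (U μ x : Matrix mm mm ℂ)) μ x = 1 := fun μ x => Matrix.mem_unitaryGroup_iff'.mp (hU μ x)
  have hY : (covLapM (scShift d L mv kk hL) ((((L ^ kk : ℕ) : ℝ))⁻¹) (gaugePair (scShift d L mv kk hL) (fun μ x => coordMat e (ContinuousLinearMap.mulLeftRight ℝ (Matrix mm mm ℂ) ((fun μ x => (U μ x : Matrix mm mm ℂ)) μ x) ((fun μ x => (U μ x : Matrix mm mm ℂ)) μ x)ᴴ))) + (scP d L mv kk hL (aK a₀ (L : ℝ) kk * (((L ^ kk : ℕ) : ℝ)) ^ (d + 1)) ι e (fun μ x => (U μ x : Matrix mm mm ℂ)))) ∘ₗ (Matrix.mulVecLin (cGreen (cvM d L mv kk hL) (L ^ kk) (cvT e (fun μ x => (U μ x : Matrix mm mm ℂ))) (aK a₀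 (L : ℝ) kk * (((L ^ kk : ℕ) : ℝ)) ^ (d + 1)))) = LinearMap.id := by
    rw [covLapM_add_scP_eq_mulVecLin_claplA ι e he (aK a₀ (L : ℝ) kk * (((L ^ kk : ℕ) : ℝ)) ^ (d + 1)) (fun μ x => (U μ x : Matrix mm mm ℂ)) hU', ← Matrix.mulVecLin_mul, claplA_mul_cGreen _ _ (isUnit_cvT ι e he (fun μ x => (U μ x : Matrix mm mm ℂ)) hU') ha', Matrix.mulVecLin_one]
  -- the letter of the cut row of `N_V` (n15-c∕277's arithmetic)
  have hσ0 : 0 ≤ ((1 + rV * ((((L ^ kk : ℕ) : ℝ))⁻¹)) ^ ((d + 1) * L ^ kk) - 1) := by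
    have := one_le_pow₀ (M₀ := ℝ) (a := 1 + rV * ((((L ^ kk : ℕ) : ℝ))⁻¹)) (by nlinarith [hη.le]) (n := (d + 1) * L ^ kk); linarith
  have hLσ0 : 0 ≤ (Fintype.card ι * (Fintype.card ι * ((1 + rV * ((((L ^ kk : ℕ) : ℝ))⁻¹)) ^ ((d + 1) * L ^ kk) - 1) ^ 2 + 2 * ((1 + rV * ((((L ^ kk : ℕ) : ℝ))⁻¹)) ^ ((d + 1) * L ^ kk) - 1))) := by positivity
  have hRN0 : 0 ≤ (aK a₀ (L : ℝ) kk * (Fintype.card ι * (Fintype.card ι * ((1 + rV * ((((L ^ kk : ℕ) : ℝ))⁻¹)) ^ ((d + 1) * L ^ kk) - 1) ^ 2 + 2 * ((1 + rV * ((((L ^ kk : ℕ) : ℝ))⁻¹)) ^ ((d + 1) * L ^ kk) - 1)))) := by positivity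
  have hRle' : rV * (1 + Fintype.card (Fin (d + 1) ⊕ Fin (d + 1))) + (aK a₀ (L : ℝ) kk * (Fintype.card ι * (Fintype.card ι * ((1 + rV * ((((L ^ kk : ℕ) : ℝ))⁻¹)) ^ ((d + 1) * L ^ kk) - 1) ^ 2 + 2 * ((1 + rV * ((((L ^ kk : ℕ) : ℝ))⁻¹)) ^ ((d + 1) * L ^ kk) - 1)))) ≤ R₀ := by
    have := mul_le_mul_of_nonneg_right haKle hLσ0; linarith
  have hrVle : rV ≤ R₀ := by
    have h1 : (0 : ℝ) ≤ Fintype.card (Fin (d + 1) ⊕ Fin (d + 1)) := by positivity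
    nlinarith
  have habs : |(aK a₀ (L : ℝ) kk * (((L ^ kk : ℕ) : ℝ)) ^ (d + 1))| * ((((L ^ kk : ℕ) : ℝ)) ^ (d + 1))⁻¹ = aK a₀ (L : ℝ) kk := by
    rw [abs_of_pos ha', mul_assoc, mul_inv_cancel₀ (by positivity), mul_one]
  have hkk0 : 0 ≤ @basisConst ι _ (Matrix mm mm ℂ) Matrix.frobeniusNormedAddCommGroup Matrix.frobeniusNormedSpace e * (2 * Real.sqrt (Fintype.card mm)) := mul_nonneg (@basisConst_nonneg ι _ (Matrix mm mm ℂ) Matrix.frobeniusNormedAddCommGroup Matrix.frobeniusNormedSpace e) (by positivity)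
  have hP0 : 0 ≤ Fintype.card ι * (@basisConst ι _ (Matrix mm mm ℂ) Matrix.frobeniusNormedAddCommGroup Matrix.frobeniusNormedSpace e * (2 * Real.sqrt (Fintype.card mm)) * (Real.sqrt (Fintype.card mm) * ((C / ξ) * Real.exp (((((L ^ kk : ℕ) : ℝ))⁻¹) * (C / ξ))))) := mul_nonneg (by positivity) (mul_nonneg hkk0 (by positivity))
  have hQ0 : 0 ≤ Fintype.card ι * (@basisConst ι _ (Matrix mm mm ℂ) Matrix.frobeniusNormedAddCommGroup Matrix.frobeniusNormedSpace e * (2 * Real.sqrt (Fintype.card mm)) * (Real.sqrt (Fintype.card mm) * ((C / ξ ^ 2) * Real.exp (((((L ^ kk : ℕ) : ℝ))⁻¹) * (C / ξ))))) := mul_nonneg (by positivity) (mul_nonneg hkk0 (by positivity))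
  -- the per-cube gauges with ALL letters (n15-c∕285) and the two-collar neighbourhoods of the cut boxes
  choose w hwu hwL using fun k => uN_exists_gauge_adjointLetters_of_reg335Cube e (scShift d L mv kk hL) U he hη hU hξ hC (h335 k)
  have hin : ∀ k (x : ScX d L mv kk hL), x ∈ {x : ScX d L mv kk hL | blockOf (L ^ kk) (cvM d L mv kk hL) x ∈ cubeBlocks (cvM d L mv kk hL) (coverCorner (cvM d L mv kk hL) (L ^ mv) L (2 * L ^ mv + 1) k) (6 * L ^ mv + 3)} → x ∈ {x : ScX d L mv kk hL | blockOf (L ^ kk) (cvM d L mv kk hL) x ∈ cubeBlocks (cvM d L mv kk hL) (coverCorner (cvM d L mv kk hL) (L ^ mv) L (2 * L ^ mv + 2) k) (6 * L ^ mv + 5)} := fun k x hx =>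
    mem_cubeBlocks_of_mem_inner (m₀ := 2 * L ^ mv + 2) (S₀ := 6 * L ^ mv + 5) hM (by omega) (by omega) hS5 hx
  have hnb : ∀ k x, scChi d L mv kk hL k x ≠ 0 → x ∈ {x : ScX d L mv kk hL | blockOf (L ^ kk) (cvM d L mv kk hL) x ∈ cubeBlocks (cvM d L mv kk hL) (coverCorner (cvM d L mv kk hL) (L ^ mv) L (2 * L ^ mv + 2) k) (6 * L ^ mv + 5)} ∧ (∀ μ, (scShift d L mv kk hL) μ x ∈ {x : ScX d L mv kk hL | blockOf (L ^ kk) (cvM d L mv kk hL) x ∈ cubeBlocks (cvM d L mv kk hL) (coverCorner (cvM d L mv kk hL) (L ^ mv) L (2 * L ^ mv + 2) k) (6 * L ^ mv + 5)}) ∧ (∀ μ, ((scShift d L mv kk hL) μ).symm x ∈ {x : ScX d L mv kk hL | blockOf (L ^ kk) (cvM d L mv kk hL) x ∈ cubeBlocks (cvM d L mv kk hL) (coverCorner (cvM d L mv kk hL) (L ^ mv) L (2 * L ^ mv + 2) k) (6 * L ^ mv + 5)}) ∧ (∀ μ, (scShift d L mv kk hL) μ ((scShift d L mv kk hL) μ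 x) ∈ {x : ScX d L mv kk hL | blockOf (L ^ kk) (cvM d L mv kk hL) x ∈ cubeBlocks (cvM d L mv kk hL) (coverCorner (cvM d L mv kk hL) (L ^ mv) L (2 * L ^ mv + 2) k) (6 * L ^ mv + 5)}) := fun k x hx => by
    obtain ⟨h0, h1, h2⟩ := scChi_ne_zero_nbhd hL hL7 mv kk k x hx
    exact ⟨hin k x h0, fun μ => hin k _ (h1 μ), fun μ => hin k _ (h2 μ), fun μ =>
      (blockOf_shift_mem_cubeBlocks (m₀ := 2 * L ^ mv + 2) (S₀ := 6 * L ^ mv + 5) hM (by omega) (by omega) hS5 (h1 μ) μ).2.1⟩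
  -- 283′'s cube rows: `P`'s conjugation law, the coefficient letters `r_V`, the quotient letters `r_D := r_V`, `N_V`'s cut row, the far row `= 0`
  have hP := fun k => scP_conj ι e (aK a₀ (L : ℝ) kk * (((L ^ kk : ℕ) : ℝ)) ^ (d + 1)) w (fun μ x => (U μ x : Matrix mm mm ℂ)) k
  have hCloc : ∀ k x, scChi d L mv kk hL k x ≠ 0 → ∀ i, ∑ j, |tCoefC ((((L ^ kk : ℕ) : ℝ))⁻¹) (gaugePair (scShift d L mv kk hL) fun μ y => coordMat e (ContinuousLinearMap.mulLeftRight ℝ (Matrix mm mm ℂ) (w k y * (U μ y : Matrix mm mm ℂ) * (w k ((scShift d L mv kk hL) μ y))ᴴ) (w k y * (U μ y : Matrix mm mm ℂ) * (w k ((scShift d L mv kk hL) μ y))ᴴ)ᴴ)) x i j| ≤ rV := fun k x hx i => ((hwL k x (hnb k x hx).1 (hnb k x hx).2.1 (hnb k x hx).2.2.1 (hnb k x hx).2.2.2).2.1 i).trans hrC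
  have hAloc : ∀ k j' x, scChi d L mv kk hL k x ≠ 0 → ∀ i, ∑ j, |tCoefA ((((L ^ kk : ℕ) : ℝ))⁻¹) (gaugePair (scShift d L mv kk hL) fun μ y => coordMat e (ContinuousLinearMap.mulLeftRight ℝ (Matrix mm mm ℂ) (w k y * (U μ y : Matrix mm mm ℂ) * (w k ((scShift d L mv kk hL) μ y))ᴴ) (w k y * (U μ y : Matrix mm mm ℂ) * (w k ((scShift d L mv kk hL) μ y))ᴴ)ᴴ)) j' x i j| ≤ rV := fun k j' x hx i => ((hwL k x (hnb k x hx).1 (hnb k x hx).2.1 (hnb k x hx).2.2.1 (hnb k x hx).2.2.2).1 j' i).trans hrA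
  have hDAf : ∀ k μ x, scChi d L mv kk hL k x ≠ 0 → ∀ i, ∑ j, |fgradMat (((L ^ kk : ℕ) : ℝ)) ((scShift d L mv kk hL) μ) (tCoefA ((((L ^ kk : ℕ) : ℝ))⁻¹) (gaugePair (scShift d L mv kk hL) fun μ y => coordMat e (ContinuousLinearMap.mulLeftRight ℝ (Matrix mm mm ℂ) (w k y * (U μ y : Matrix mm mm ℂ) * (w k ((scShift d L mv kk hL) μ y))ᴴ) (w k y * (U μ y : Matrix mm mm ℂ) * (w k ((scShift d L mv kk hL) μ y))ᴴ)ᴴ)) (Sum.inl μ)) x i j| ≤ rV := fun k μ x hx i => by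
    have h := rowSum_fgradMat_tCoefA_inl_le_at ((((L ^ kk : ℕ) : ℝ))⁻¹) (scShift d L mv kk hL) (fun ν y => coordMat e (ContinuousLinearMap.mulLeftRight ℝ (Matrix mm mm ℂ) (w k y * (U ν y : Matrix mm mm ℂ) * (w k ((scShift d L mv kk hL) ν y))ᴴ) (w k y * (U ν y : Matrix mm mm ℂ) * (w k ((scShift d L mv kk hL) ν y))ᴴ)ᴴ)) hη ((hwL k x (hnb k x hx).1 (hnb k x hx).2.1 (hnb k x hx).2.2.1 (hnb k x hx).2.2.2).2.2.2.2.1 μ) i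
    rw [inv_inv] at h
    exact h.trans hrQ
  have hDAb : ∀ k μ x, scChi d L mv kk hL k x ≠ 0 → ∀ i, ∑ j, |fgradMat (((L ^ kk : ℕ) : ℝ)) ((scShift d L mv kk hL) μ) (tCoefA ((((L ^ kk : ℕ) : ℝ))⁻¹) (gaugePair (scShift d L mv kk hL) fun μ y => coordMat e (ContinuousLinearMap.mulLeftRight ℝ (Matrix mm mm ℂ) (w k y * (U μ y : Matrix mm mm ℂ) * (w k ((scShift d L mv kk hL) μ y))ᴴ) (w k y * (U μ y : Matrix mm mm ℂ) * (w k ((scShift d L mv kk hL) μ y))ᴴ)ᴴ)) (Sum.inr μ)) x i j| ≤ rV := fun k μ x hx i => by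
    have h := rowSum_fgradMat_tCoefA_inr_le_at ((((L ^ kk : ℕ) : ℝ))⁻¹) (scShift d L mv kk hL) (fun ν y => coordMat e (ContinuousLinearMap.mulLeftRight ℝ (Matrix mm mm ℂ) (w k y * (U ν y : Matrix mm mm ℂ) * (w k ((scShift d L mv kk hL) ν y))ᴴ) (w k y * (U ν y : Matrix mm mm ℂ) * (w k ((scShift d L mv kk hL) ν y))ᴴ)ᴴ)) hη ((hwL k x (hnb k x hx).1 (hnb k x hx).2.1 (hnb k x hx).2.2.1 (hnb k x hx).2.2.2).2.2.2.2.2 μ) i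
    rw [inv_inv] at h
    exact h.trans hrQ
  have hNVcut : ∀ k, HasMaj (ScNorm d L mv kk hL ι) (ScNorm d L mv kk hL ι) (mulOp (fun p : ScX d L mv kk hL × ι => scPsi d L mv kk hL k p.1) ∘ₗ (scNV d L mv kk hL (aK a₀ (L : ℝ) kk * (((L ^ kk : ℕ) : ℝ)) ^ (d + 1)) ι e w (fun μ x => (U μ x : Matrix mm mm ℂ))) k ∘ₗ mulOp (fun p : ScX d L mv kk hL × ι => scChi d L mv kk hL k p.1))
      (fun y y' => (aK a₀ (L : ℝ) kk * (Fintype.card ι * (Fintype.card ι * ((1 + rV * ((((L ^ kk : ℕ) : ℝ))⁻¹)) ^ ((d + 1) * L ^ kk) - 1) ^ 2 + 2 * ((1 + rV * ((((L ^ kk : ℕ) : ℝ))⁻¹)) ^ ((d + 1) * L ^ kk) - 1)))) * Real.exp (-(δ * (unitTorusGeo L kk (cvM d L mv kk hL)).dist y y'))) := fun k =>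
    (hasMaj_scNV_cut_of_rows ι e he (aK a₀ (L : ℝ) kk * (((L ^ kk : ℕ) : ℝ)) ^ (d + 1)) (fun k x => hwu k x) (fun μ x => (U μ x : Matrix mm mm ℂ)) hrV k (fun μ x hx i => hAloc k (Sum.inl μ) x hx i) δ).mono fun y y' =>
      mul_le_mul_of_nonneg_right (le_of_eq (by rw [habs])) (Real.exp_nonneg _)
  have hfarN : ∀ k, HasMaj (ScNorm d L mv kk hL ι) (ScNorm d L mv kk hL ι) (mulOp (fun p : ScX d L mv kk hL × ι => scH d L mv kk hL k p.1) ∘ₗ (scNV d L mv kk hL (aK a₀ (L : ℝ) kk * (((L ^ kk : ℕ) : ℝ)) ^ (d + 1)) ι e w (fun μ x => (U μ x : Matrix mm mm ℂ))) k ∘ₗ (LinearMap.id - mulOp (fun p : ScX d L mv kk hL × ι => scBump d L mv kk hL k p.1)))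
      (fun y y' => (0 : ℝ) * Real.exp (-(δ * (unitTorusGeo L kk (cvM d L mv kk hL)).dist y y'))) := fun k => by
    rw [scNV_eq ι e he (aK a₀ (L : ℝ) kk * (((L ^ kk : ℕ) : ℝ)) ^ (d + 1)) (fun k x => hwu k x) (fun μ x => (U μ x : Matrix mm mm ℂ)) k,
      mulOp_comp_mulVecLin_comp_one_sub_mulOp_eq_zero ι _ (fun p q hpq => csavgSq_sub_apply_of_ne ι (aK a₀ (L : ℝ) kk * (((L ^ kk : ℕ) : ℝ)) ^ (d + 1)) _ hpq) fun x x' hx hb => scBump_eq_one_of_scH_ne_zero_of_blockOf_eq hw hx hb]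
    exact (hasMaj_zero _ _).mono fun y y' => by rw [zero_mul]
  -- the right factor `E := D*_{U,ν}`: the gauges, the covariant shape (284), the Leibniz rule (284), the rows on the cut box (285)
  have hug : ∀ k x, (fun x => coordMat e (ContinuousLinearMap.mulLeftRight ℝ (Matrix mm mm ℂ) (w k x) (w k x)ᴴ)) x * ((fun x => coordMat e (ContinuousLinearMap.mulLeftRight ℝ (Matrix mm mm ℂ) (w k x) (w k x)ᴴ)) x)ᵀ = 1 := fun k x => (uN_siteGauge_orthogonal e (w k) he (hwu k) x).1
  have hug' : ∀ k x, ((fun x => coordMat e (ContinuousLinearMap.mulLeftRight ℝ (Matrix mm mm ℂ) (w k x) (w k x)ᴴ)) x)ᵀ * (fun x => coordMat e (ContinuousLinearMap.mulLeftRight ℝ (Matrix mm mm ℂ) (w k x) (w k x)ᴴ)) x = 1 := fun k x => (uN_siteGauge_orthogonal e (w k) he (hwu k) x).2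
  have hWS : ∀ k ν y, (fun x => coordMat e (ContinuousLinearMap.mulLeftRight ℝ (Matrix mm mm ℂ) (w k x) (w k x)ᴴ)) y * (cvT e (fun μ x => (U μ x : Matrix mm mm ℂ))) ν y * ((fun x => coordMat e (ContinuousLinearMap.mulLeftRight ℝ (Matrix mm mm ℂ) (w k x) (w k x)ᴴ)) ((scShift d L mv kk hL) ν y))ᵀ = (fun ν y => coordMat e (ContinuousLinearMap.mulLeftRight ℝ (Matrix mm mm ℂ) (w k y * (U ν y : Matrix mm mm ℂ) * (w k ((scShift d L mv kk hL) ν y))ᴴ) (w k y * (U ν y : Matrix mm mm ℂ) * (w k ((scShift d L mv kk hL) ν y))ᴴ)ᴴ)) ν y := fun k ν y => uN_conj_coordMat_eq e (scShift d L mv kk hL) he (hwu k) (fun μ x => (U μ x : Matrix mm mm ℂ)) ν y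
  -- the partition's forward quotient letter
  have hξ0 : ∀ μ ν (x : ScX d L mv kk hL), ∃ z : ℤ, scXi d L mv kk hL ν (scShift d L mv kk hL μ x) =
      scXi d L mv kk hL ν x + (if ν = μ then ((((L ^ kk : ℕ) : ℝ)) * ((L ^ mv : ℕ) : ℝ))⁻¹ else 0) + (z : ℝ) * ((2 * L : ℕ) : ℝ) :=
    fun μ ν x => coverXi_shift (n := L ^ kk) (q := L) hM hw μ ν (x, 0)
  have hsW : |((((L ^ kk : ℕ) : ℝ))⁻¹)⁻¹| * (π * |((((L ^ kk : ℕ) : ℝ)) * ((L ^ mv : ℕ) : ℝ))⁻¹|) = π / ((L ^ mv : ℕ) : ℝ) := by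
    rw [inv_inv, abs_of_pos hnr, abs_of_nonneg (by positivity), mul_inv]; field_simp
  have hν : ∀ ν, HasMaj (ScNorm d L mv kk hL ι) (ScNorm d L mv kk hL ι) ((Matrix.mulVecLin (cGreen (cvM d L mv kk hL) (L ^ kk) (cvT e (fun μ x => (U μ x : Matrix mm mm ℂ))) (aK a₀ (L : ℝ) kk * (((L ^ kk : ℕ) : ℝ)) ^ (d + 1)))) ∘ₗ covD ((((L ^ kk : ℕ) : ℝ))⁻¹) (fun y => ((cvT e (fun μ x => (U μ x : Matrix mm mm ℂ))) ν (((scShift d L mv kk hL) ν).symm y))ᵀ) ⇑((scShift d L mv kk hL) ν).symm)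
      (fun y y' => (B₀ + B₁ + 2 * B₂) * (1 + rV) * Real.exp (-(δ / 16 * (unitTorusGeo L kk (cvM d L mv kk hL)).dist y y'))) := fun ν => by
    have hleib : ∀ k, mulOp (fun p : ScX d L mv kk hL × ι => scH d L mv kk hL k p.1) ∘ₗ (covD ((((L ^ kk : ℕ) : ℝ))⁻¹) (fun y => ((cvT e (fun μ x => (U μ x : Matrix mm mm ℂ))) ν (((scShift d L mv kk hL) ν).symm y))ᵀ) ⇑((scShift d L mv kk hL) ν).symm) =
        (covD ((((L ^ kk : ℕ) : ℝ))⁻¹) (fun y => ((cvT e (fun μ x => (U μ x : Matrix mm mm ℂ))) ν (((scShift d L mv kk hL) ν).symm y))ᵀ) ⇑((scShift d L mv kk hL) ν).symm) ∘ₗ mulOp (fun p : ScX d L mv kk hL × ι => scH d L mv kk hL k ((scShift d L mv kk hL) ν p.1)) + mulOp (fun p : ScX d L mv kk hL × ι => (fun k x => fgrad ((((L ^ kk : ℕ) : ℝ))⁻¹)⁻¹ ((scShift d L mv kk hL) ν) (scH d L mv kk hL k) x) k p.1) := fun k =>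
      mulOp_comp_covD_symm ((((L ^ kk : ℕ) : ℝ))⁻¹) (fun y => ((cvT e (fun μ x => (U μ x : Matrix mm mm ℂ))) ν (((scShift d L mv kk hL) ν).symm y))ᵀ) ((scShift d L mv kk hL) ν) (scH d L mv kk hL k)
    have hdh : ∀ k x, |(fun k x => fgrad ((((L ^ kk : ℕ) : ℝ))⁻¹)⁻¹ ((scShift d L mv kk hL) ν) (scH d L mv kk hL k) x) k x| ≤ π / ((L ^ mv : ℕ) : ℝ) := fun k x =>
      (abs_fgrad_hcube_le (2 * L) (scXi d L mv kk hL) (scShift d L mv kk hL) hK0 hξ0 _ k ν x).trans hsW.le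
    have hEcov : ∀ k, mmulOp (fun x => coordMat e (ContinuousLinearMap.mulLeftRight ℝ (Matrix mm mm ℂ) (w k x) (w k x)ᴴ)) ∘ₗ (covD ((((L ^ kk : ℕ) : ℝ))⁻¹) (fun y => ((cvT e (fun μ x => (U μ x : Matrix mm mm ℂ))) ν (((scShift d L mv kk hL) ν).symm y))ᵀ) ⇑((scShift d L mv kk hL) ν).symm) ∘ₗ mmulOp (fun x => ((fun x => coordMat e (ContinuousLinearMap.mulLeftRight ℝ (Matrix mm mm ℂ) (w k x) (w k x)ᴴ)) x)ᵀ) = mmulOp ((fun k y => -((fun x => coordMat e (ContinuousLinearMap.mulLeftRight ℝ (Matrix mm mm ℂ) (w k x) (w k x)ᴴ)) y * ((cvT e (fun μ x => (U μ x : Matrix mm mm ℂ))) ν (((scShift d L mv kk hL) ν).symm y))ᵀ * ((fun x => coordMat e (ContinuousLinearMap.mulLeftRight ℝ (Matrix mm mm ℂ) (w k x) (w k x)ᴴ)) (((scShift d L mv kk hL) ν).symm y))ᵀ)) k) ∘ₗ bgrad (((L ^ kk : ℕ) : ℝ)) (liftEquiv ((scShift d L mv kk hL) ν) ι) + mmulOp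 ((fun k y => (((L ^ kk : ℕ) : ℝ)) • (((fun x => coordMat e (ContinuousLinearMap.mulLeftRight ℝ (Matrix mm mm ℂ) (w k x) (w k x)ᴴ)) y * ((cvT e (fun μ x => (U μ x : Matrix mm mm ℂ))) ν (((scShift d L mv kk hL) ν).symm y))ᵀ * ((fun x => coordMat e (ContinuousLinearMap.mulLeftRight ℝ (Matrix mm mm ℂ) (w k x) (w k x)ᴴ)) (((scShift d L mv kk hL) ν).symm y))ᵀ) - 1)) k) := fun k => by
      have h := covD_symm_covShape (hug k) (hug' k) ((((L ^ kk : ℕ) : ℝ))⁻¹) (fun y => ((cvT e (fun μ x => (U μ x : Matrix mm mm ℂ))) ν (((scShift d L mv kk hL) ν).symm y))ᵀ) ((scShift d L mv kk hL) ν)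
      rw [inv_inv] at h
      exact h
    have hRE : ∀ k x, scChi d L mv kk hL k x ≠ 0 → ∀ i, ∑ j, |((fun k y => -((fun x => coordMat e (ContinuousLinearMap.mulLeftRight ℝ (Matrix mm mm ℂ) (w k x) (w k x)ᴴ)) y * ((cvT e (fun μ x => (U μ x : Matrix mm mm ℂ))) ν (((scShift d L mv kk hL) ν).symm y))ᵀ * ((fun x => coordMat e (ContinuousLinearMap.mulLeftRight ℝ (Matrix mm mm ℂ) (w k x) (w k x)ᴴ)) (((scShift d L mv kk hL) ν).symm y))ᵀ)) k ∘ ⇑((scShift d L mv kk hL) ν)) x i j| ≤ 1 + rV := fun k x hx i => by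
      refine (rowSum_neg_conj_shift_le_at ((((L ^ kk : ℕ) : ℝ))⁻¹) (scShift d L mv kk hL) (fun ν y => coordMat e (ContinuousLinearMap.mulLeftRight ℝ (Matrix mm mm ℂ) (w k y * (U ν y : Matrix mm mm ℂ) * (w k ((scShift d L mv kk hL) ν y))ᴴ) (w k y * (U ν y : Matrix mm mm ℂ) * (w k ((scShift d L mv kk hL) ν y))ᴴ)ᴴ)) (hWS k) ((hwL k x (hnb k x hx).1 (hnb k x hx).2.1 (hnb k x hx).2.2.1 (hnb k x hx).2.2.2).2.2.1 ν) i).trans ?_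
      nlinarith [hP0, hηle, hη.le, hrA]
    have hRE' : ∀ k x, scChi d L mv kk hL k x ≠ 0 → ∀ i, ∑ j, |(fgradMat (((L ^ kk : ℕ) : ℝ)) ((scShift d L mv kk hL) ν) ((fun k y => -((fun x => coordMat e (ContinuousLinearMap.mulLeftRight ℝ (Matrix mm mm ℂ) (w k x) (w k x)ᴴ)) y * ((cvT e (fun μ x => (U μ x : Matrix mm mm ℂ))) ν (((scShift d L mv kk hL) ν).symm y))ᵀ * ((fun x => coordMat e (ContinuousLinearMap.mulLeftRight ℝ (Matrix mm mm ℂ) (w k x) (w k x)ᴴ)) (((scShift d L mv kk hL) ν).symm y))ᵀ)) k)) x i j| ≤ rV := fun k x hx i => by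
      have h := rowSum_fgradMat_neg_conj_le_at ((((L ^ kk : ℕ) : ℝ))⁻¹) (scShift d L mv kk hL) (fun ν y => coordMat e (ContinuousLinearMap.mulLeftRight ℝ (Matrix mm mm ℂ) (w k y * (U ν y : Matrix mm mm ℂ) * (w k ((scShift d L mv kk hL) ν y))ᴴ) (w k y * (U ν y : Matrix mm mm ℂ) * (w k ((scShift d L mv kk hL) ν y))ᴴ)ᴴ)) (hWS k) hη ((hwL k x (hnb k x hx).1 (hnb k x hx).2.1 (hnb k x hx).2.2.1 (hnb k x hx).2.2.2).2.2.2.2.2 ν) i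
      rw [inv_inv] at h
      refine h.trans ?_
      nlinarith [hQ0, hηle, hη.le, hrQ]
    have hBE : ∀ k x, scChi d L mv kk hL k x ≠ 0 → ∀ i, ∑ j, |(fun k y => (((L ^ kk : ℕ) : ℝ)) • (((fun x => coordMat e (ContinuousLinearMap.mulLeftRight ℝ (Matrix mm mm ℂ) (w k x) (w k x)ᴴ)) y * ((cvT e (fun μ x => (U μ x : Matrix mm mm ℂ))) ν (((scShift d L mv kk hL) ν).symm y))ᵀ * ((fun x => coordMat e (ContinuousLinearMap.mulLeftRight ℝ (Matrix mm mm ℂ) (w k x) (w k x)ᴴ)) (((scShift d L mv kk hL) ν).symm y))ᵀ) - 1)) k x i j| ≤ rV := fun k x hx i => by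
      have h := rowSum_smul_conj_sub_one_le_at ((((L ^ kk : ℕ) : ℝ))⁻¹) (scShift d L mv kk hL) (fun ν y => coordMat e (ContinuousLinearMap.mulLeftRight ℝ (Matrix mm mm ℂ) (w k y * (U ν y : Matrix mm mm ℂ) * (w k ((scShift d L mv kk hL) ν y))ᴴ) (w k y * (U ν y : Matrix mm mm ℂ) * (w k ((scShift d L mv kk hL) ν y))ᴴ)ᴴ)) (hWS k) hη ((hwL k x (hnb k x hx).1 (hnb k x hx).2.1 (hnb k x hx).2.2.1 (hnb k x hx).2.2.2).2.2.2.1 ν) i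
      rw [inv_inv] at h
      exact h.trans hrA
    have key := H mv kk hk hw₀' e he w hwu (fun μ x => (U μ x : Matrix mm mm ℂ)) (scP d L mv kk hL (aK a₀ (L : ℝ) kk * (((L ^ kk : ℕ) : ℝ)) ^ (d + 1)) ι e (fun μ x => (U μ x : Matrix mm mm ℂ))) (scNV d L mv kk hL (aK a₀ (L : ℝ) kk * (((L ^ kk : ℕ) : ℝ)) ^ (d + 1)) ι e w (fun μ x => (U μ x : Matrix mm mm ℂ))) rV rV (aK a₀ (L : ℝ) kk * (Fintype.card ι * (Fintype.card ι * ((1 + rV * ((((L ^ kk : ℕ) : ℝ))⁻¹)) ^ ((d + 1) * L ^ kk) - 1) ^ 2 + 2 * ((1 + rV * ((((L ^ kk : ℕ) : ℝ))⁻¹)) ^ ((d + 1) * L ^ kk) - 1)))) 0 hrV hrV hRN0 le_rfl hRle' hrVle hθ₀.le hP hCloc hAloc hDAf hDAb hNVcut hfarN ν (covD ((((L ^ kk : ℕ) : ℝ))⁻¹) (fun y => ((cvT e (fun μ x => (U μ x : Matrix mm mm ℂ))) ν (((scShift d L mv kk hL) ν).symm y))ᵀ) ⇑((scShift d L mv kk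 hL) ν).symm)
      ((fun k y => -((fun x => coordMat e (ContinuousLinearMap.mulLeftRight ℝ (Matrix mm mm ℂ) (w k x) (w k x)ᴴ)) y * ((cvT e (fun μ x => (U μ x : Matrix mm mm ℂ))) ν (((scShift d L mv kk hL) ν).symm y))ᵀ * ((fun x => coordMat e (ContinuousLinearMap.mulLeftRight ℝ (Matrix mm mm ℂ) (w k x) (w k x)ᴴ)) (((scShift d L mv kk hL) ν).symm y))ᵀ))) ((fun k y => (((L ^ kk : ℕ) : ℝ)) • (((fun x => coordMat e (ContinuousLinearMap.mulLeftRight ℝ (Matrix mm mm ℂ) (w k x) (w k x)ᴴ)) y * ((cvT e (fun μ x => (U μ x : Matrix mm mm ℂ))) ν (((scShift d L mv kk hL) ν).symm y))ᵀ * ((fun x => coordMat e (ContinuousLinearMap.mulLeftRight ℝ (Matrix mm mm ℂ) (w k x) (w k x)ᴴ)) (((scShift d L mv kk hL) ν).symm y))ᵀ) - 1))) (fun k x => fgrad ((((L ^ kk : ℕ) : ℝ))⁻¹)⁻¹ ((scShift d L mv kk hL) ν) (scH d L mv kk hL k) x) (1 + rV) rV rV (by positivity) hrV hrV hleib hdh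 hEcov hRE hRE' hBE (Matrix.mulVecLin (cGreen (cvM d L mv kk hL) (L ^ kk) (cvT e (fun μ x => (U μ x : Matrix mm mm ℂ))) (aK a₀ (L : ℝ) kk * (((L ^ kk : ℕ) : ℝ)) ^ (d + 1)))) hY
    refine key.mono fun y y' => mul_le_mul_of_nonneg_right ?_ (Real.exp_nonneg _)
    nlinarith [hB₀, hB₁, hB₂, hrV]
  exact ⟨hν, hasMaj_mulVecLin_mul_cgradT ι (by positivity) hν⟩

end Green

end Summit.QuantumFields.YangMills.BalabanUVNodes.N15.Gluing

end
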